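import Summits.BirchSwinnertonDyer.BirchSwinnertonDyer.Theses.UniversalToricDescent
import Summits.BirchSwinnertonDyer.BirchSwinnertonDyer.Theorems.UniversalToricDescentToricTransportModThreeTwinMuZero
import Literature.NumberTheory.EllipticCurves.Hsieh2014.AnticyclotomicMuInvariantAnyLevel
import HarnessLib

/-!
# Route `UniversalToricDescent` — RK-7 v3 glue `TwinMuZeroAtThreeOfThmB` BY NAME (TEMPLATE — file once the pen's v3 route edit has ADDED
# the item; `--workitem <G id>`)

`TwinMuZeroAtThreeOfThmB := TwinHsiehThmBInput → TwinMuZeroAtThree` (pen sketch `Cruxes/ToricTransportModThree/RK7_sketch_pen_g9_v3.lean`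
@e69cc76e1891): Hsieh 2014 Thm B at any level (item 20711, typed named fact) gives, for every twin frame, a coefficient of norm one —
`Hsieh2014.thmB_exists_isHsiehLFunction_coeff_norm_eq_one_of_anyLevel` read into the route's frame currency by the landed
`…UniversalToricDescentTwinMuZero.twinMuZeroAtThree_of_thmB` (p540587, utd-p1 g3). CONDITIONAL on the displayed print input; BSD is proved
for no curve by this file.
-/

set_option linter.dupNamespace false
set_option autoImplicit false

namespace Summit.BirchSwinnertonDyer.BirchSwinnertonDyer.Theorems.UniversalToricDescentTwinMuZeroAtThreeOfThmB

open Summit.BirchSwinnertonDyer.BirchSwinnertonDyer.Theses.UniversalToricDescent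

/-- **glue `TwinMuZeroAtThreeOfThmB` BY NAME** (RK-7 v3): `TwinHsiehThmBInput → TwinMuZeroAtThree`, by p540587 ∘ the any-level reading of
Hsieh 2014 Thm B. CONDITIONAL; closes the glue item only. [cite: Hsieh2014, Thm. B] -/
theorem twinMuZeroAtThreeOfThmB_proof : TwinMuZeroAtThreeOfThmB := fun hThmB ↦
  Summit.BirchSwinnertonDyer.BirchSwinnertonDyer.Theorems.UniversalToricDescentTwinMuZero.twinMuZeroAtThree_of_thmB
    (Literature.NumberTheory.EllipticCurves.Hsieh2014.thmB_exists_isHsiehLFunction_coeff_norm_eq_one_of_anyLevel hThmB)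

end Summit.BirchSwinnertonDyer.BirchSwinnertonDyer.Theorems.UniversalToricDescentTwinMuZeroAtThreeOfThmB
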